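import Summits.BirchSwinnertonDyer.BirchSwinnertonDyer.Theorems.ResidualThetaTransportAtTwoAwayDefs
import Summits.BirchSwinnertonDyer.BirchSwinnertonDyer.Theorems.ResidualThetaTransportAtTwoResidualSignedLambdaLowerCMAtTwoCofreeSelmerTransferRelaxedAtTwo
import Summits.BirchSwinnertonDyer.BirchSwinnertonDyer.Theorems.ResidualThetaTransportAtTwoResidualSignedLambdaLowerCMAtTwoRhoLayerPairingGlueAwayTwo
import HarnessLib

/-!
# T1 (AtTwo package), part (f): the S2 value character `pair₂` and the local value character `c₂` AGREE through `loc₂` —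
# `pair₂ t s = c₂ t (loc₂ s)` for every class (both are VALUE-pinned on the same Θ-Kummer data, and every class has a datum)

Route `ResidualThetaTransportAtTwo` (RTT), crux RSL_g `ResidualSignedLambdaLowerCMAtTwo` (stmt-BirchSwinnertonDyer-22608), line «onepair», GLUE-SPEC-g18 §1
T1 (f) («compat with S2: `pair₂ t s = π₂.c₂ t (loc₂ s)` on `Sg`»); seat `prover-bsd-wall-tp2-p2x-w2` g20 (`--supports`, closes nothing). THEOREMS ONLY.
BSD is not proved by any of this; RSL_g (22608) stays OPEN.

* **`pair₂_eq_c₂_locKer`** — on the habitat (`GoodSS W 2`, `κ` cyclotomic, `v ∋ 2`), for ANY `P : 𝔉₂ →+ CharacterModule ↥Sg` carrying S2's (VAL) pin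
  (`stub_plusColemanO`, second clause) and ANY `c₂ : 𝔉₂ →+ CharacterModule D₂` carrying `AtTwoPins.hc₂`: `P t s = c₂ t (locKer … v s)` for every `s ∈ Sg`.
  Proof: a global Θ-Kummer datum `(φ, Q, k)` of `s` exists (p695679 `CofreeSelmerTransfer.exists_kummerData`); it is a datum for `P`, and its pull-back
  `(φ ∘ res, Q, k)` is a local datum of `loc₂ s` (`locKer_oneCocycleClass`, `locKer_pullback_apply`, p700007); both pins return `(t(2^kQ) mod 2^k)·2^{-k}`.

References: [Kobayashi2003] Thm. 6.2, (8.23) (p. 18); [PerrinRiou1994Invent] §3.6.1; [CoatesGreenberg1996] Cor. 3.2.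
-/

set_option autoImplicit false
-- the Theorems namespace of this sub repeats the summit name by design (D-0017 nested layout)
set_option linter.dupNamespace false

noncomputable section

open scoped Classical

namespace Summit.BirchSwinnertonDyer.BirchSwinnertonDyer.Theorems.ThetaTransport.AtTwoPackage

open CategoryTheory Field NumberField IsDedekindDomain WeierstrassCurve
  Literature.NumberTheory.EllipticCurves Literature.NumberTheory.GaloisRepresentations
  Literature.NumberTheory.EllipticCurves.GreenbergSelmer Literature.NumberTheory.EllipticCurves.CyclotomicLayer
  Literature.NumberTheory.EllipticCurves.Kobayashi2003 Literature.NumberTheory.EllipticCurves.Sprung2012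
  Summit.BirchSwinnertonDyer.BirchSwinnertonDyer.Theorems.OnePair

variable (S : Set (PadicAlgCl 2)) (ρ : FramedGaloisRep ℚ ↥(padicCoeffIntegers S) 2)
  (W : WeierstrassCurve ℚ) [W.IsElliptic] [W.IsGloballyMinimal] (κ : ZpExtension ℚ 2) {r : ℕ}
  (Θ : ∀ v : HeightOneSpectrum (𝓞 ℚ), ((2 : ℕ) : 𝓞 ℚ) ∈ v.asIdeal → (Cofree ρ ↥(padicCoeffField S) ≃+ (Fin r → ↥(W.geomPrimaryTorsion 2))))
  (hΘ : ∀ v hv (δ : absoluteGaloisGroup (v.adicCompletion ℚ)) m i,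
    Θ v hv (resGalOfEmb (closureEmb (K := ℚ) (v.adicCompletion ℚ)) δ • m) i = resGalOfEmb (closureEmb (K := ℚ) (v.adicCompletion ℚ)) δ • Θ v hv m i)
  (v : HeightOneSpectrum (𝓞 ℚ)) (hv : ((2 : ℕ) : 𝓞 ℚ) ∈ v.asIdeal)

include hΘ in
/-- **T1 (f): `pair₂ t s = c₂ t (loc₂ s)`.** Any S2 value character `P` (VALUE-pinned on global Θ-Kummer data of the classes of `Sg`) and any local value
character `c₂` (VALUE-pinned on local Θ-Kummer data, `AtTwoPins.hc₂`) agree through `locKer … v`: every class has a global datum (`exists_kummerData`), whose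
pull-back to `U_{∞,v}` is a local datum of `loc₂ s`. [cite: Kobayashi2003, Thm. 6.2 and (8.23) (p. 18)] [cite: CoatesGreenberg1996, Cor. 3.2] -/
theorem pair₂_eq_c₂_locKer (hGood : Rank1Residual.GoodSS W 2) (hκ : κ.IsCyclotomic)
    (Sg : AddSubgroup (subgroupH1 κ.kerSubgroup (Cofree ρ ↥(padicCoeffField S))))
    (P : ((Fin r → ↥(localTowerPointsOfEmb κ (closureEmb (K := ℚ) (v.adicCompletion ℚ)) W)) →+ ℤ_[2]) →+ CharacterModule ↥Sg)
    (hP : ∀ (t : (Fin r → ↥(localTowerPointsOfEmb κ (closureEmb (K := ℚ) (v.adicCompletion ℚ)) W)) →+ ℤ_[2]) (s : ↥Sg)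
      (φ : contOneCocycles (discreteTopRep ↥κ.kerSubgroup (Cofree ρ ↥(padicCoeffField S))))
      (Q : Fin r → localPoints W (v.adicCompletion ℚ)) (k : ℕ)
      (hQ : ∀ i, (2 ^ k) • Q i ∈ localTowerPointsOfEmb κ (closureEmb (K := ℚ) (v.adicCompletion ℚ)) W),
      oneCocycleClass (discreteTopRep ↥κ.kerSubgroup (Cofree ρ ↥(padicCoeffField S))) φ =
          (s : subgroupH1 κ.kerSubgroup (Cofree ρ ↥(padicCoeffField S))) →
        (∀ (τ : ↥(localSubgroupOfEmb κ.kerSubgroup (closureEmb (K := ℚ) (v.adicCompletion ℚ)))) (i : Fin r),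
          pointsMapOfEmb W (closureEmb (K := ℚ) (v.adicCompletion ℚ))
            ((Θ v hv (φ.1 (resGalSubgroupOfEmb κ.kerSubgroup (closureEmb (K := ℚ) (v.adicCompletion ℚ)) τ)) i : ↥(W.geomPrimaryTorsion 2)) :
              W.geomPoints) = (τ : absoluteGaloisGroup (v.adicCompletion ℚ)) • Q i - Q i) →
        P t s = (PadicInt.toZModPow k (t (fun i => ⟨(2 ^ k) • Q i, hQ i⟩))).val • ((((2 : ℚ) ^ k)⁻¹ : ℚ) : AddCircle (1 : ℚ)))
    (c₂ : ((Fin r → ↥(localTowerPointsOfEmb κ (closureEmb (K := ℚ) (v.adicCompletion ℚ)) W)) →+ ℤ_[2]) →+ CharacterModule (Dloc S κ ρ v))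
    (hc₂ : ∀ (t : (Fin r → ↥(localTowerPointsOfEmb κ (closureEmb (K := ℚ) (v.adicCompletion ℚ)) W)) →+ ℤ_[2])
      (y : Dloc S κ ρ v) (ψ : contOneCocycles (subgroupRep (localRepOf (cofreeGaloisModule S ρ) v) (kerGroup κ v)))
      (Q : Fin r → localPoints W (v.adicCompletion ℚ)) (k : ℕ)
      (hQ : ∀ i, (2 ^ k) • Q i ∈ localTowerPointsOfEmb κ (closureEmb (K := ℚ) (v.adicCompletion ℚ)) W),
      oneCocycleClass (subgroupRep (localRepOf (cofreeGaloisModule S ρ) v) (kerGroup κ v)) ψ = y →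
      (∀ (τ : ↥(kerGroup κ v)) (i : Fin r), pointsMapOfEmb W (closureEmb (K := ℚ) (v.adicCompletion ℚ))
        ((Θ v hv (ψ.1 τ) i : ↥(W.geomPrimaryTorsion 2)) : W.geomPoints) = (τ : absoluteGaloisGroup (v.adicCompletion ℚ)) • Q i - Q i) →
      c₂ t y = (PadicInt.toZModPow k (t (fun i => ⟨(2 ^ k) • Q i, hQ i⟩))).val • ((((2 : ℚ) ^ k)⁻¹ : ℚ) : AddCircle (1 : ℚ)))
    (t : (Fin r → ↥(localTowerPointsOfEmb κ (closureEmb (K := ℚ) (v.adicCompletion ℚ)) W)) →+ ℤ_[2]) (s : ↥Sg) :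
    P t s = c₂ t (locKer S κ ρ v (s : subgroupH1 κ.kerSubgroup (Cofree ρ ↥(padicCoeffField S)))) := by
  obtain ⟨φ, Q, k, hφ, hQ, hK⟩ := CofreeSelmerTransfer.exists_kummerData W hGood κ hκ Θ hΘ
    (s : subgroupH1 κ.kerSubgroup (Cofree ρ ↥(padicCoeffField S))) v hv
  rw [hP t s φ Q k hQ hφ (fun τ i ↦ hK τ i), ← hφ]
  rw [locKer_oneCocycleClass]
  exact (hc₂ t _ _ Q k hQ rfl (fun τ i ↦ by rw [locKer_pullback_apply]; exact hK τ i)).symm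

end Summit.BirchSwinnertonDyer.BirchSwinnertonDyer.Theorems.ThetaTransport.AtTwoPackage

end
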